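/-
COR-CM (cell pub-hodgecm2, stage 2 of the Hodge ladder) — count-neutral KERNEL COMBINATORICS «the order-16 dispatch», part V: the INSTANCES — the hypothesis
binders of parts III–IV are inhabited on Mathlibʼs `DihedralGroup 4 × Multiplicative (ℤ/2)` (dihedral quotient data in element form: `c = (r², 1)`, `n′ = (1, x)`,
`u = (r, 1)`, `w = (s, 1)`) and `QuaternionGroup 2 × Multiplicative (ℤ/2)` (a quaternion pair in element form: `c = (a², 1)`, `i = (a, 1)`, `j = (xa₀, 1)`); and
the law itself on both rows (seat prover-pub-hodgecm2-b23-g55-0, binder prover b23, gen 55; claim HOME/INBOX.md l.25631).  Theorems only; `decide` only on closed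
identities in `DihedralGroup 4`, `QuaternionGroup 2`, `ℤ/2` and products of them; no certificate, no named fact, no `sorry`.  `Interfaces.lean` (C1), every E
term, B01, `Transposition/*`, `PortJoin/*`, `D2Bridge/*` untouched.
HONEST FRAMING: `HC_CM` is NOT proved, here or anywhere in the tree; nothing here is a period, a count of record or a headline.
T5: this file IS the inhabitation check of parts III (`isLeast_of_dihedral_elements`, `isLeast_of_quaternion_elements`) and IV (the law); checker: self.
-/
import Summits.HodgeConjecture.CorCM.Census.OrderSixteenLaw

/-!
# The order-16 dispatch, V: instances

* §1 `D₄ × ℤ/2`, `c = (r², 1)`: the dihedral-element hypotheses of part III hold for `n′ = (1, x)`, `u = (r, 1)`, `w = (s, 1)` (`dihedralProd_elements`), hence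
  `isLeast_card_gfaces_generate_fibreTwo_dihedralProd` — the row `μ(D₄ × ℤ/2, (r², 0)) = φ₂` through the element-form brick; and through the law.
* §2 `Q₈ × ℤ/2`, `c = (a², 1)`: `i = (a 1, 1)`, `j = (xa 0, 1)` satisfy `i² = j² = c`, `i j = c · j i` (`quaternionProd_elements`), hence
  `isLeast_card_gfaces_generate_fibreTwo_quaternionProd`; and through the law.
All [folklore].

## References
* [Pohlmann1968] H. Pohlmann, Algebraic cycles on abelian varieties of complex multiplication type, Ann. of Math. 88 (1968), Thm 1.
-/

namespace Summit.HodgeConjecture.CorCM.Census.OrderSixteen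

open DihedralGroup QuaternionGroup
open Summit.HodgeConjecture.CorCM.Prior.AllgGroup.RfwfAllgGroup
open Summit.HodgeConjecture.CorCM.Census.BlockParity
open Summit.HodgeConjecture.CorCM.Census.Coinvariant

noncomputable section

/-! ## §1 `D₄ × ℤ/2` with `c = (r², 1)` -/

section DihedralProd

/-- `|D₄ × ℤ/2| = 16`. [folklore] -/
theorem card_dihedralProd : Nat.card (DihedralGroup 4 × Multiplicative (ZMod 2)) = 16 := by
  rw [Nat.card_prod, Nat.card_eq_fintype_card, Nat.card_eq_fintype_card, DihedralGroup.card]; rfl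

/-- `c = (r², 1)` is a central involution `≠ 1` of `D₄ × ℤ/2`. [folklore] -/
theorem dihedralProd_c :
    ((r 2, 1) : DihedralGroup 4 × Multiplicative (ZMod 2)) * (r 2, 1) = 1 ∧ ((r 2, 1) : DihedralGroup 4 × Multiplicative (ZMod 2)) ≠ 1 ∧
      ∀ x : DihedralGroup 4 × Multiplicative (ZMod 2), x * (r 2, 1) = (r 2, 1) * x := by
  refine ⟨by decide, by decide, by decide⟩

/-- **The dihedral-element hypotheses of part III on `D₄ × ℤ/2`**: `n′ = (1, x)` is a central involution `∉ {1, c}`, `u = (r, 1)`, `w = (s, 1)` do not commute,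
`u² = c`, `w² = 1`, `(w u)² = 1`. [folklore] -/
theorem dihedralProd_elements :
    (∀ x : DihedralGroup 4 × Multiplicative (ZMod 2), x * (1, Multiplicative.ofAdd 1) = (1, Multiplicative.ofAdd 1) * x) ∧
    ((1, Multiplicative.ofAdd 1) : DihedralGroup 4 × Multiplicative (ZMod 2)) * (1, Multiplicative.ofAdd 1) = 1 ∧
    ((1, Multiplicative.ofAdd 1) : DihedralGroup 4 × Multiplicative (ZMod 2)) ≠ 1 ∧
    ((1, Multiplicative.ofAdd 1) : DihedralGroup 4 × Multiplicative (ZMod 2)) ≠ (r 2, 1) ∧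
    ((r 1, 1) : DihedralGroup 4 × Multiplicative (ZMod 2)) * (sr 0, 1) ≠ (sr 0, 1) * (r 1, 1) ∧
    ((r 1, 1) : DihedralGroup 4 × Multiplicative (ZMod 2)) * (r 1, 1) = (r 2, 1) ∧
    ((sr 0, 1) : DihedralGroup 4 × Multiplicative (ZMod 2)) * (sr 0, 1) = 1 ∧
    ((sr 0, 1) : DihedralGroup 4 × Multiplicative (ZMod 2)) * (r 1, 1) * ((sr 0, 1) * (r 1, 1)) = 1 := by
  refine ⟨by decide, by decide, by decide, by decide, by decide, by decide, by decide, by decide⟩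

/-- **The row `D₄ × ℤ/2`, `c = (r², 1)`, THROUGH THE ELEMENT-FORM BRICK** (part III §1 is inhabited): `μ = φ₂`. [folklore] -/
theorem isLeast_card_gfaces_generate_fibreTwo_dihedralProd :
    IsLeast {m : ℕ | ∃ S : Finset (CMF (DihedralGroup 4 × Multiplicative (ZMod 2)) (r 2, 1) →₀ ℤ),
      (↑S ⊆ gfaceSet (DihedralGroup 4 × Multiplicative (ZMod 2)) (r 2, 1) dihedralProd_c.1) ∧ S.card = m ∧
      hodgeSpan ((r 2, 1) : DihedralGroup 4 × Multiplicative (ZMod 2)) dihedralProd_c.1 ≤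
        Submodule.span ℤ (pairSet ((r 2, 1) : DihedralGroup 4 × Multiplicative (ZMod 2))) ⊔ Submodule.span ℤ (translates (r 2, 1) S)}
      (fibreTwo ((r 2, 1) : DihedralGroup 4 × Multiplicative (ZMod 2)) dihedralProd_c.1) := by
  classical
  obtain ⟨hncen, hnn, hn1, hnc, huw, hu, hw, hwu⟩ := dihedralProd_elements
  exact isLeast_of_dihedral_elements card_dihedralProd dihedralProd_c.1 dihedralProd_c.2.1 dihedralProd_c.2.2 hncen hnn hn1 hnc huw
    (Or.inl hu) (Or.inl hw) (Or.inl hwu)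

/-- The same row through THE LAW (part IV). [folklore] -/
theorem isLeast_card_gfaces_generate_fibreTwo_dihedralProd' :
    IsLeast {m : ℕ | ∃ S : Finset (CMF (DihedralGroup 4 × Multiplicative (ZMod 2)) (r 2, 1) →₀ ℤ),
      (↑S ⊆ gfaceSet (DihedralGroup 4 × Multiplicative (ZMod 2)) (r 2, 1) dihedralProd_c.1) ∧ S.card = m ∧
      hodgeSpan ((r 2, 1) : DihedralGroup 4 × Multiplicative (ZMod 2)) dihedralProd_c.1 ≤
        Submodule.span ℤ (pairSet ((r 2, 1) : DihedralGroup 4 × Multiplicative (ZMod 2))) ⊔ Submodule.span ℤ (translates (r 2, 1) S)}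
      (fibreTwo ((r 2, 1) : DihedralGroup 4 × Multiplicative (ZMod 2)) dihedralProd_c.1) := by
  classical
  exact isLeast_card_gfaces_generate_fibreTwo_of_natCard_eq_sixteen _ card_dihedralProd dihedralProd_c.1 dihedralProd_c.2.1 dihedralProd_c.2.2

end DihedralProd

/-! ## §2 `Q₈ × ℤ/2` with `c = (a², 1)` -/

section QuaternionProd

/-- `|Q₈ × ℤ/2| = 16`. [folklore] -/
theorem card_quaternionProd : Nat.card (QuaternionGroup 2 × Multiplicative (ZMod 2)) = 16 := by
  rw [Nat.card_prod, Nat.card_eq_fintype_card, Nat.card_eq_fintype_card, QuaternionGroup.card]; rfl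

/-- `c = (a², 1)` is a central involution `≠ 1` of `Q₈ × ℤ/2`. [folklore] -/
theorem quaternionProd_c :
    ((a 2, 1) : QuaternionGroup 2 × Multiplicative (ZMod 2)) * (a 2, 1) = 1 ∧ ((a 2, 1) : QuaternionGroup 2 × Multiplicative (ZMod 2)) ≠ 1 ∧
      ∀ x : QuaternionGroup 2 × Multiplicative (ZMod 2), x * (a 2, 1) = (a 2, 1) * x := by
  refine ⟨by decide, by decide, by decide⟩

/-- **The quaternion-element hypotheses of part III on `Q₈ × ℤ/2`**: `i = (a, 1)`, `j = (xa₀, 1)`: `i² = j² = c`, `i j = c · j i`. [folklore] -/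
theorem quaternionProd_elements :
    ((a 1, 1) : QuaternionGroup 2 × Multiplicative (ZMod 2)) * (a 1, 1) = (a 2, 1) ∧
    ((xa 0, 1) : QuaternionGroup 2 × Multiplicative (ZMod 2)) * (xa 0, 1) = (a 2, 1) ∧
    ((a 1, 1) : QuaternionGroup 2 × Multiplicative (ZMod 2)) * (xa 0, 1) = (a 2, 1) * ((xa 0, 1) * (a 1, 1)) := by
  refine ⟨by decide, by decide, by decide⟩

/-- **The row `Q₈ × ℤ/2`, `c = (a², 1)`, THROUGH THE ELEMENT-FORM BRICK** (part III §2 is inhabited): `μ = φ₂`. [folklore] -/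
theorem isLeast_card_gfaces_generate_fibreTwo_quaternionProd :
    IsLeast {m : ℕ | ∃ S : Finset (CMF (QuaternionGroup 2 × Multiplicative (ZMod 2)) (a 2, 1) →₀ ℤ),
      (↑S ⊆ gfaceSet (QuaternionGroup 2 × Multiplicative (ZMod 2)) (a 2, 1) quaternionProd_c.1) ∧ S.card = m ∧
      hodgeSpan ((a 2, 1) : QuaternionGroup 2 × Multiplicative (ZMod 2)) quaternionProd_c.1 ≤
        Submodule.span ℤ (pairSet ((a 2, 1) : QuaternionGroup 2 × Multiplicative (ZMod 2))) ⊔ Submodule.span ℤ (translates (a 2, 1) S)}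
      (fibreTwo ((a 2, 1) : QuaternionGroup 2 × Multiplicative (ZMod 2)) quaternionProd_c.1) := by
  classical
  obtain ⟨hii, hjj, hij⟩ := quaternionProd_elements
  exact isLeast_of_quaternion_elements card_quaternionProd quaternionProd_c.1 quaternionProd_c.2.1 quaternionProd_c.2.2 hii hjj hij

/-- The same row through THE LAW (part IV). [folklore] -/
theorem isLeast_card_gfaces_generate_fibreTwo_quaternionProd' :
    IsLeast {m : ℕ | ∃ S : Finset (CMF (QuaternionGroup 2 × Multiplicative (ZMod 2)) (a 2, 1) →₀ ℤ),
      (↑S ⊆ gfaceSet (QuaternionGroup 2 × Multiplicative (ZMod 2)) (a 2, 1) quaternionProd_c.1) ∧ S.card = m ∧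
      hodgeSpan ((a 2, 1) : QuaternionGroup 2 × Multiplicative (ZMod 2)) quaternionProd_c.1 ≤
        Submodule.span ℤ (pairSet ((a 2, 1) : QuaternionGroup 2 × Multiplicative (ZMod 2))) ⊔ Submodule.span ℤ (translates (a 2, 1) S)}
      (fibreTwo ((a 2, 1) : QuaternionGroup 2 × Multiplicative (ZMod 2)) quaternionProd_c.1) := by
  classical
  exact isLeast_card_gfaces_generate_fibreTwo_of_natCard_eq_sixteen _ card_quaternionProd quaternionProd_c.1 quaternionProd_c.2.1
    quaternionProd_c.2.2

end QuaternionProd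

end

end Summit.HodgeConjecture.CorCM.Census.OrderSixteen
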